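import Mathlib
import Summits.PneNP.PneNP.Theorems.ConvexRankGatesConvexGateBlindAffineRank
import Summits.PneNP.PneNP.Theorems.ConvexRankGatesConvexGateBlindCodimension

/-!
# PneNP / ConvexRankGates — `ConvexGateBlind`: the codimension theorem on the TRANSPOSED side (affine defect of the column objects)

Helpers (`--supports stmt-PneNP-10680`), COLUMN-SPACE line (prover seat 2, session 24).

`…AffineRank.lean`: a factorisation `cdist Q u − ε = ∑_{l<R} U_l(u) V_l(Q)` (`ε > 0`, `V_l ≥ 0` on `k`-sets) all of whose
column objects are AFFINE in the graph (`U_l(u) = a_l − t_l(u) ≥ 0` on `k`-clique-free `u`) needs `R ≥ C(m,k)`. Here the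
column objects are arbitrary non-negative functions of the clique-free graph, of AFFINE DEFECT `≤ p`: every `p + 1` of them
admit a non-trivial linear combination that is affine on clique-free graphs (equivalently `dim(span{U_l} + Aff) ≤ dim Aff + p`,
`Aff` = affine functions of `1_u` restricted to `k`-clique-free graphs). Then

    C(m,k) ≤ (R + 1)^{p+1}

(`affine_codim_terms_lower_bound`; registered form `affine_codim_terms_ge_choose`). PROOF — the session-23 argument
transposed: in the quotient (functions on clique-free graphs) ⧸ Aff the images `ū_l` have every `p+1` of them related, and
for each `k`-set `Q` the row `(V_l(Q))_l ≥ 0` is a non-negative relation (`∑_l V_l(Q) U_l = cdist(Q,·) − ε` IS affine in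
the graph, `cdist_eq_card_sub_sum`). Support-canonical conic Carathéodory (`ConicSupport.exists_conic_decomposition`) writes
each row as a non-negative combination of canonical generators `g_T`, `#T ≤ p+1`; each `U_T := ∑_l g_T(l) U_l` is affine
AND `≥ 0` on clique-free graphs, so the factorisation is rewritten with affine column objects indexed by the
`≤ (R+1)^{p+1}` small supports, and `affine_terms_lower_bound` applies. Consequence (eventual forms in
`…AffineEventual.lean`): polynomial-size LP refutations of the crux have affine defect `Ω(m^δ / c)` on the column side —
they are polynomially far from restricted on BOTH sides. [new]
-/

set_option linter.dupNamespace false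

namespace Summit.PneNP.PneNP.Theorems

open Finset Real Filter Literature.Computability.Complexity
open Summit.PneNP.PneNP.Cruxes.ConvexGateBlind.StrictRankConicCover (Edge cdist)

noncomputable section

variable {m : ℕ}

/-- **Codimension theorem, transposed side (fixed `m`).** Let `3 ≤ k`, `ε > 0`, and
`cdist Q u − ε = ∑_{l<R} U_l(u) V_l(Q)` for all `k`-sets `Q` and all `k`-clique-free `u`, with `U_l ≥ 0` on clique-free graphs
and `V_l ≥ 0` on `k`-sets. If every `p + 1` of the column objects `U_l` have a non-trivial linear combination that is affine
in the graph on `k`-clique-free graphs (affine defect `≤ p`), then `C(m,k) ≤ (R+1)^{p+1}`. [new] -/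
theorem affine_codim_terms_lower_bound {k R p : ℕ} (hk : 3 ≤ k)
    (U : (Edge m → Bool) → Fin R → ℝ) (V : Fin R → Finset (Fin m) → ℝ)
    (hU : ∀ u l, cliqueFn m k u = false → 0 ≤ U u l)
    (hV : ∀ l (Q : Finset (Fin m)), Q.card = k → 0 ≤ V l Q) (ε : ℝ) (hε : 0 < ε)
    (hfact : ∀ (Q : Finset (Fin m)) (u : Edge m → Bool), Q.card = k → cliqueFn m k u = false →
      cdist Q u - ε = ∑ l, U u l * V l Q)
    (hP : ∀ s : Finset (Fin R), s.card = p + 1 → ∃ h : Fin R → ℝ, (∀ l, l ∉ s → h l = 0) ∧ h ≠ 0 ∧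
      ∃ (a : ℝ) (t : Edge m → ℝ), ∀ u : Edge m → Bool, cliqueFn m k u = false →
        ∑ l, h l * U u l = a - ∑ f, (if u f = true then t f else 0)) :
    m.choose k ≤ (R + 1) ^ (p + 1) := by
  classical
  -- ambient space: functions on clique-free graphs; the affine functions of the graph
  set Y : (ℝ × (Edge m → ℝ)) →ₗ[ℝ] ({u : Edge m → Bool // cliqueFn m k u = false} → ℝ) :=
    { toFun := fun at' u => at'.1 - ∑ f, (if u.1 f = true then at'.2 f else 0)
      map_add' := fun x x' => by
        funext u
        simp only [Prod.fst_add, Prod.snd_add, Pi.add_apply]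
        have : ∑ f, (if u.1 f = true then x.2 f + x'.2 f else 0) =
            ∑ f, (if u.1 f = true then x.2 f else 0) + ∑ f, (if u.1 f = true then x'.2 f else 0) := by
          rw [← Finset.sum_add_distrib]
          exact Finset.sum_congr rfl fun f _ => by split_ifs <;> simp
        rw [this]; ring
      map_smul' := fun c x => by
        funext u
        simp only [Prod.smul_fst, Prod.smul_snd, smul_eq_mul, RingHom.id_apply, Pi.smul_apply]
        have : ∑ f, (if u.1 f = true then c * x.2 f else 0) = c * ∑ f, (if u.1 f = true then x.2 f else 0) := by
          rw [Finset.mul_sum]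
          exact Finset.sum_congr rfl fun f _ => by split_ifs <;> simp
        rw [this]; ring } with hY
  have hYapply : ∀ (at' : ℝ × (Edge m → ℝ)) (u : {u : Edge m → Bool // cliqueFn m k u = false}),
      Y at' u = at'.1 - ∑ f, (if u.1 f = true then at'.2 f else 0) := fun _ _ => rfl
  set A : Submodule ℝ ({u : Edge m → Bool // cliqueFn m k u = false} → ℝ) := LinearMap.range Y with hA
  -- column objects as vectors, and their images in the quotient
  set Uf : Fin R → ({u : Edge m → Bool // cliqueFn m k u = false} → ℝ) := fun l u => U u.1 l with hUf
  set y : Fin R → ({u : Edge m → Bool // cliqueFn m k u = false} → ℝ) ⧸ A := fun l => A.mkQ (Uf l) with hy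
  have hcomb : ∀ (h : Fin R → ℝ) (u : {u : Edge m → Bool // cliqueFn m k u = false}),
      (∑ l, h l • Uf l) u = ∑ l, h l * U u.1 l := by
    intro h u
    rw [Finset.sum_apply]
    exact Finset.sum_congr rfl fun l _ => by rw [Pi.smul_apply, smul_eq_mul]
  have hy_comb : ∀ h : Fin R → ℝ, ∑ l, h l • y l = A.mkQ (∑ l, h l • Uf l) := by
    intro h
    rw [map_sum]
    exact Finset.sum_congr rfl fun l _ => by rw [map_smul]
  have hrel_iff : ∀ h : Fin R → ℝ, ∑ l, h l • y l = 0 ↔ ∃ at' : ℝ × (Edge m → ℝ), Y at' = ∑ l, h l • Uf l := by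
    intro h
    rw [hy_comb, Submodule.mkQ_apply, Submodule.Quotient.mk_eq_zero, hA, LinearMap.mem_range]
  -- every `p + 1` column objects are related in the quotient
  have hp : ∀ s : Finset (Fin R), s.card = p + 1 →
      ∃ h : Fin R → ℝ, (∀ l, l ∉ s → h l = 0) ∧ h ≠ 0 ∧ ∑ l, h l • y l = 0 := by
    intro s hs
    obtain ⟨h, hhs, hhne, a, t, hat⟩ := hP s hs
    refine ⟨h, hhs, hhne, (hrel_iff h).2 ⟨(a, t), funext fun u => ?_⟩⟩
    rw [hYapply, hcomb, hat u.1 u.2]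
  -- rows (indexed by `k`-sets) are non-negative relations: `∑_l V_l(Q) U_l = cdist(Q,·) − ε` is affine in the graph
  have hrow : ∀ Q : Finset (Fin m), Q.card = k → ∑ l, V l Q • y l = 0 := by
    intro Q hQ
    rw [hrel_iff]
    refine ⟨(((cliqueEdges Q).card : ℝ) - ε, fun f => if cliqueVec Q f = true then (1 : ℝ) else 0), funext fun u => ?_⟩
    rw [hYapply, hcomb]
    dsimp only
    have h := hfact Q u.1 hQ u.2
    rw [cdist_eq_card_sub_sum] at h
    rw [show ∑ l, V l Q * U u.1 l = ∑ l, U u.1 l * V l Q from Finset.sum_congr rfl fun l _ => mul_comm _ _, ← h]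
    ring
  -- canonical generators and their affine representatives
  set g : Finset (Fin R) → Fin R → ℝ := ConicSupport.canonGen y with hg
  have hgA : ∀ T : Finset (Fin R), ∃ at' : ℝ × (Edge m → ℝ), Y at' = ∑ l, g T l • Uf l :=
    fun T => (hrel_iff (g T)).1 (ConicSupport.sum_canonGen_smul y T)
  choose atT hatT using hgA
  -- decompositions of the rows
  have hdec : ∀ Q : Finset (Fin m), Q.card = k → ∃ lam : Finset (Fin R) → ℝ,
      (∀ T, 0 ≤ lam T) ∧ (∀ T, p + 1 < T.card → lam T = 0) ∧ ∀ l, V l Q = ∑ T, lam T * g T l :=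
    fun Q hQ => ConicSupport.exists_conic_decomposition y p hp (fun l => V l Q) (fun l => hV l Q hQ) (hrow Q hQ)
  -- the affine factorisation, indexed by supports of size `≤ p + 1`
  set N : ℕ := Fintype.card {T : Finset (Fin R) // T.card ≤ p + 1} with hN
  set eqv := Fintype.equivFin {T : Finset (Fin R) // T.card ≤ p + 1} with heqv
  set U' : (Edge m → Bool) → Fin N → ℝ := fun u i => ∑ l, g (eqv.symm i).1 l * U u l with hU'
  set V' : Fin N → Finset (Fin m) → ℝ := fun i Q =>
    if hQ : Q.card = k then Classical.choose (hdec Q hQ) (eqv.symm i).1 else 0 with hV'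
  have hU'nn : ∀ u i, cliqueFn m k u = false → 0 ≤ U' u i := by
    intro u i hu
    rw [hU']
    exact Finset.sum_nonneg fun l _ => mul_nonneg (ConicSupport.canonGen_nonneg y _ l) (hU u l hu)
  have hV'nn : ∀ i (Q : Finset (Fin m)), Q.card = k → 0 ≤ V' i Q := by
    intro i Q hQ
    rw [hV']
    dsimp only
    rw [dif_pos hQ]
    exact (Classical.choose_spec (hdec Q hQ)).1 _
  have hU'aff : ∀ i, ∃ (a : ℝ) (t : Edge m → ℝ), ∀ u, cliqueFn m k u = false →
      U' u i = a - ∑ f, (if u f = true then t f else 0) := by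
    intro i
    refine ⟨(atT (eqv.symm i).1).1, (atT (eqv.symm i).1).2, fun u hu => ?_⟩
    have h := congrFun (hatT (eqv.symm i).1) ⟨u, hu⟩
    rw [hYapply, hcomb] at h
    rw [hU']
    dsimp only
    rw [← h]
  have hfact' : ∀ (Q : Finset (Fin m)) (u : Edge m → Bool), Q.card = k → cliqueFn m k u = false →
      cdist Q u - ε = ∑ i, U' u i * V' i Q := by
    intro Q u hQ hu
    obtain ⟨hlam0, hlambig, hlam⟩ := Classical.choose_spec (hdec Q hQ)
    set lam := Classical.choose (hdec Q hQ) with hlamdef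
    have hrhs : ∑ i, U' u i * V' i Q =
        ∑ T : {T : Finset (Fin R) // T.card ≤ p + 1}, (∑ l, g T.1 l * U u l) * lam T.1 := by
      rw [← eqv.symm.sum_comp]
      refine Finset.sum_congr rfl fun i _ => ?_
      rw [hU', hV']
      dsimp only
      rw [dif_pos hQ]
    have hall : ∑ T : {T : Finset (Fin R) // T.card ≤ p + 1}, (∑ l, g T.1 l * U u l) * lam T.1 =
        ∑ T : Finset (Fin R), (∑ l, g T l * U u l) * lam T := by
      have hsub := Finset.sum_subtype (Finset.univ.filter fun T : Finset (Fin R) => T.card ≤ p + 1)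
          (p := fun T : Finset (Fin R) => T.card ≤ p + 1) (F := inferInstance) (fun T => by simp)
          (fun T : Finset (Fin R) => (∑ l, g T l * U u l) * lam T)
      rw [← Finset.sum_filter_add_sum_filter_not Finset.univ (fun T : Finset (Fin R) => T.card ≤ p + 1), hsub]
      rw [Finset.sum_eq_zero (s := Finset.univ.filter fun T : Finset (Fin R) => ¬ T.card ≤ p + 1), add_zero]
      intro T hT
      rw [Finset.mem_filter] at hT
      rw [hlambig T (by omega), mul_zero]
    rw [hrhs, hall, hfact Q u hQ hu]
    -- swap sums
    calc ∑ l, U u l * V l Q = ∑ l, U u l * ∑ T, lam T * g T l :=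
          Finset.sum_congr rfl fun l _ => by rw [hlam l]
      _ = ∑ l, ∑ T, g T l * U u l * lam T := by
          refine Finset.sum_congr rfl fun l _ => ?_
          rw [Finset.mul_sum]
          exact Finset.sum_congr rfl fun T _ => by ring
      _ = ∑ T, ∑ l, g T l * U u l * lam T := Finset.sum_comm
      _ = ∑ T, (∑ l, g T l * U u l) * lam T := Finset.sum_congr rfl fun T _ => by rw [Finset.sum_mul]
  -- the affine count
  have hlb := affine_terms_lower_bound hk U' V' hU'nn hV'nn hU'aff ε hε hfact'
  have hNle : N ≤ (R + 1) ^ (p + 1) := by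
    have h := card_subtype_card_le_pow R p
    rw [← hN] at h
    exact h
  exact hlb.trans hNle

/-- **Codimension theorem, transposed side** (registered form of `affine_codim_terms_lower_bound`). [new] -/
theorem affine_codim_terms_ge_choose : ∀ {m k R p : ℕ}, 3 ≤ k → ∀ (U : (Edge m → Bool) → Fin R → ℝ) (V : Fin R → Finset (Fin m) → ℝ), (∀ u l, cliqueFn m k u = false → 0 ≤ U u l) → (∀ l (Q : Finset (Fin m)), Q.card = k → 0 ≤ V l Q) → ∀ (ε : ℝ), 0 < ε → (∀ (Q : Finset (Fin m)) (u : Edge m → Bool), Q.card = k → cliqueFn m k u = false → cdist Q u - ε = ∑ l, U u l * V l Q) → (∀ s : Finset (Fin R), s.card = p + 1 → ∃ h : Fin R → ℝ, (∀ l, l ∉ s → h l = 0) ∧ h ≠ 0 ∧ ∃ (a : ℝ) (t : Edge m → ℝ), ∀ u : Edge m → Bool, cliqueFn m k u = false → ∑ l, h l * U u l = a - ∑ f, (if u f = true then t f else 0)) → m.choose k ≤ (R + 1) ^ (p + 1) :=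
  fun hk U V hU hV ε hε hfact hP => affine_codim_terms_lower_bound hk U V hU hV ε hε hfact hP

end

end Summit.PneNP.PneNP.Theorems
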